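import Mathlib
import HarnessLib
import Literature.AlgebraicGeometry.HodgeTheory.FlatFamilyCycleClass
import Literature.AlgebraicGeometry.HodgeTheory.HypersurfaceLefschetz
import Literature.AlgebraicGeometry.HodgeTheory.GysinFormalismPushforward
import Literature.AlgebraicGeometry.HodgeTheory.ZariskiClosedNowhereDense
import Literature.AlgebraicGeometry.Motives.VarietiesGeometricallyIntegralProofs
import Literature.AlgebraicTopology.SingularHomology.CupProduct
import Literature.AlgebraicGeometry.HodgeTheory.AbsoluteHodgeClassesDegreeZero

/-!
# Fulton's specialisation of the cycle class of a flat family: the degenerate corners, and the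
# reduction of the stub `stub_fultonSpecialises` to the interior range `1 ≤ p ≤ n`

HONEST FRAMING: helper file for the crux `BlochSpreadEightFour` (stmt-HodgeConjecture-18884), line
`Lines/bloch_lifts_fulton.lean`, stub `stub_fultonSpecialises : fulton1998_flatFamily_cycleClass_specialises`
(the tree's NAMED FACT, Fulton 1998 Prop. 10.1 (a), Cor. 10.1, Lemma 19.1.1, Cor. 19.2 (b), on the real
carriers `complexBetti`, `classesSupportedOn`, `algebraicClasses`). The stub is NOT closed here and nothing in
this file proves `BlochSpreadEightFour`, rung H2, HC_AV or HC. What IS proved (sorry-free, no new notion,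
no named fact consumed):

* `classesSupportedOn_univ_eq_top` — every class is supported on the whole scheme (off `Z = X` there is
  no complex point, so the target of the restriction map is `0`).
* `eq_univ_of_isClosed_of_coheight_eq_zero` — on the (integral) fibre `X₀ = 𝒳_{v₀}` of a smooth
  projective family a Zariski-closed set containing a point of codimension `0` is everything (that point
  is the generic point).
* `not_lt_of_coheight_eq` — on such a fibre a point of codimension `p` forces `p ≤ n` (`dim + codim = n`).
* `fulton1998_flatFamily_cycleClass_specialises_zero` — the fact in the corner `p = 0`, in its own binder
  shape: `W₀ = X₀`, `Γ := 1_𝒳`, `w := 1_{X₀} = Γ|_{X₀}` (`f^* 1 = 1`), `c₀ := 1`; every class of `H⁰` is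
  algebraic in codimension `0` (`algebraicClasses_eq_top_of_eq_zero_or_le`).
* `fulton1998_flatFamily_cycleClass_specialises_of_lt` — the fact in the corner `n < p` (vacuous: the
  binder `∃ z ∈ W₀, codim z = p` is unsatisfiable above the dimension).
* `fulton1998_flatFamily_cycleClass_specialises_of_interior` — **reduction**: the named fact follows from
  its restriction to `0 < p ≤ n` (the hypothesis `h` is the fact's statement with `0 < p → p ≤ n →`
  inserted after the binder `(g : 𝒳 ⟶ V)`). A future discharge may therefore assume
  `1 ≤ p ≤ n = dim X₀`, where the printed meaning of all carriers is the intended one; the consumer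
  (`BlochSpreadEightFour`, `(n, p) = (8, 4)`) lives in that range.

References: [Fulton1998] §10.1 Prop. 10.1 (a), Cor. 10.1; §19.1 eq. (1), Lemma 19.1.1; §19.2 Cor. 19.2 (b).
[HatcherAT2002] §3.1 p. 199 (`H⁰`), §3.2 p. 211 and Prop. 3.10 (the unit and `f^* 1 = 1`).
[Hartshorne1977] II Ex. 3.20 (d) (`dim + codim`), II Prop. 3.1 / Ex. 2.9 (generic point).
-/

-- every declaration of this problem lives in `Summit.HodgeConjecture.HodgeConjecture.…` (summit = sub-problem)
set_option linter.dupNamespace false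

noncomputable section

open CategoryTheory CategoryTheory.Limits AlgebraicGeometry
open Literature.AlgebraicGeometry.Motives Literature.AlgebraicGeometry.HodgeTheory
open Literature.AlgebraicTopology.SingularHomology

namespace Summit.HodgeConjecture.HodgeConjecture.Theorems

/-! ### Three pieces of bookkeeping -/

/-- **Every class is supported on the whole scheme**: `classesSupportedOn X X k = ⊤` — off `Z = X` there
is no complex point, so `Hᵏ((X ∖ X)(ℂ); ℂ) = 0` and the restriction map kills everything.
[cite: GrothendieckTopology1969, §1] -/
theorem classesSupportedOn_univ_eq_top (X : SchemeOver ℂ) (k : ℕ) :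
    classesSupportedOn X (Set.univ : Set X.left) k = ⊤ := by
  haveI : IsEmpty (complexPointsCompl X (Set.univ : Set X.left)) := ⟨fun P ↦ P.2 (Set.mem_univ _)⟩
  haveI := ModuleCat.subsingleton_of_isZero
    (isZero_singularCohomology_of_isEmpty ℂ ℂ (E := complexPointsCompl X (Set.univ : Set X.left)) k)
  exact eq_top_iff.2 fun x _ ↦ mem_classesSupportedOn_iff.2 (Subsingleton.elim _ _)

variable {𝒳 V : SchemeOver ℂ}

/-- **A closed set of the fibre containing a point of codimension `0` is everything.** The fibre
`X₀ = 𝒳_{v₀}` of a smooth projective family is integral (`IsSmoothProjective.isIntegral_holds`); a point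
of `coheight 0` is maximal for the specialisation order, hence specialises to the generic point, which
then lies in the closed set `W₀`; so `W₀ ⊇ closure {η} = X₀`. [cite: Hartshorne1977, II Prop. 3.1 and Ex. 2.9] -/
theorem eq_univ_of_isClosed_of_coheight_eq_zero {n : ℕ} {g : 𝒳 ⟶ V}
    (hg : IsSmoothProjectiveFamily g n) {v₀ : ComplexPoints V} {W₀ : Set (fiberOver g v₀).left}
    (hW₀ : IsClosed W₀) {z : (fiberOver g v₀).left} (hz : z ∈ W₀)
    (hz0 : Order.coheight z = ((0 : ℕ) : ℕ∞)) : W₀ = Set.univ := by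
  haveI : IsIntegral (fiberOver g v₀).left :=
    IsSmoothProjective.isIntegral_holds (hg.isSmoothProjective v₀)
  have hmax : IsMax z := Order.coheight_eq_zero.1 (by simpa using hz0)
  have h1 : z ⤳ genericPoint (fiberOver g v₀).left :=
    Scheme.le_iff_specializes.1 (hmax (Scheme.le_iff_specializes.2 (genericPoint_specializes _)))
  have hη : genericPoint (fiberOver g v₀).left ∈ W₀ :=
    hW₀.closure_subset_iff.2 (Set.singleton_subset_iff.2 hz) h1.mem_closure
  apply Set.eq_univ_of_univ_subset
  rw [← genericPoint_closure ((fiberOver g v₀).left : Type _)]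
  exact hW₀.closure_subset_iff.2 (Set.singleton_subset_iff.2 hη)

/-- **Codimension is at most the dimension on a fibre**: a point of codimension `p` on the fibre
`X₀ = 𝒳_{v₀}` of a smooth projective family of relative dimension `n` has `p ≤ n`
(`dim + codim = n`, `exists_height_eq_coheight_eq`). [cite: Hartshorne1977, II Ex. 3.20 (d)] -/
theorem not_lt_of_coheight_eq {n p : ℕ} {g : 𝒳 ⟶ V} (hg : IsSmoothProjectiveFamily g n)
    {v₀ : ComplexPoints V} {z : (fiberOver g v₀).left} (hz : Order.coheight z = (p : ℕ∞)) :
    ¬ n < p := by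
  obtain ⟨a, c, -, hc, hac⟩ := exists_height_eq_coheight_eq (hg.isSmoothProjective v₀) z
  rw [hz] at hc
  have : p = c := by exact_mod_cast hc
  omega

/-! ### The fact in its corners, and the reduction to the interior range -/

/-- **Fulton's fact in codimension `p = 0` holds outright.** By the last binder `W₀` contains a point of
codimension `0`, so `W₀ = X₀` (`eq_univ_of_isClosed_of_coheight_eq_zero`); take `Γ := 1 ∈ H⁰(𝒳(ℂ); ℂ)`,
`w := 1 ∈ H⁰(X₀(ℂ); ℂ)` (non-zero, `X₀(ℂ) ≠ ∅`, the tree's `singularCohomology_one_ne_zero`; supported on `X₀`; `= Γ|_{X₀}` since `f^* 1 = 1`) and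
`c₀ := 1`: every fibre restriction of `Γ` is algebraic because `algebraicClasses (𝒳_t) 0 = ⊤`, and
`Γ|_{X₀} - 1 • w = 0` is supported on `C`. Binder shape: that of
`fulton1998_flatFamily_cycleClass_specialises` at `p = 0`.
[cite: Fulton1998, §19.1 eq. (1) and Lemma 19.1.1 (codimension 0: the class of X)] -/
theorem fulton1998_flatFamily_cycleClass_specialises_zero :
    ∀ ⦃n : ℕ⦄ ⦃𝒳 V : SchemeOver ℂ⦄ (g : 𝒳 ⟶ V), IsSmoothProjectiveFamily g n →
    AlgebraicGeometry.Smooth V.hom →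
    ∀ (𝒲 : Scheme) (ι : 𝒲 ⟶ 𝒳.left), IsClosedImmersion ι → Flat (ι ≫ g.left) →
    ∀ (v₀ : ComplexPoints V) (W₀ C : Set (fiberOver g v₀).left),
    IsClosed W₀ → IsIrreducible W₀ → IsClosed C →
    Set.range (pullback.snd ι (fiberι g v₀).left).base = W₀ ∪ C → ¬ (W₀ ⊆ C) →
    (∀ z ∈ W₀ ∪ C, ((0 : ℕ) : ℕ∞) ≤ Order.coheight z) → (∃ z ∈ W₀, Order.coheight z = (0 : ℕ)) →
    ∃ (Γ : complexBetti 𝒳 (2 * 0)) (w : complexBetti (fiberOver g v₀) (2 * 0)) (c₀ : ℂ),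
      (∀ t : ComplexPoints V,
        complexBetti.map (fiberι g t) (2 * 0) Γ ∈ algebraicClasses (fiberOver g t) 0) ∧
      w ∈ classesSupportedOn (fiberOver g v₀) W₀ (2 * 0) ∧ w ≠ 0 ∧ c₀ ≠ 0 ∧
      complexBetti.map (fiberι g v₀) (2 * 0) Γ - c₀ • w ∈
        classesSupportedOn (fiberOver g v₀) C (2 * 0) := by
  intro n 𝒳 V g hg _ 𝒲 ι _ _ v₀ W₀ C hW₀ _ _ _ _ _ hz
  obtain ⟨z, hz, hz0⟩ := hz
  have hW : W₀ = Set.univ := eq_univ_of_isClosed_of_coheight_eq_zero hg hW₀ hz hz0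
  haveI : Nonempty (ComplexPoints (fiberOver g v₀)) := nonempty_complexPoints (hg.isSmoothProjective v₀)
  refine ⟨singularCohomology.one ℂ (ComplexPoints 𝒳),
    singularCohomology.one ℂ (ComplexPoints (fiberOver g v₀)), 1, fun t => ?_, ?_,
    Literature.AlgebraicGeometry.HodgeTheory.singularCohomology_one_ne_zero, one_ne_zero, ?_⟩
  · rw [algebraicClasses_eq_top_of_eq_zero_or_le (hg.isSmoothProjective t) (Or.inl rfl)]
    exact Submodule.mem_top
  · rw [hW, classesSupportedOn_univ_eq_top]
    exact Submodule.mem_top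
  · have h1 : complexBetti.map (fiberι g v₀) (2 * 0) (singularCohomology.one ℂ (ComplexPoints 𝒳)) =
        singularCohomology.one ℂ (ComplexPoints (fiberOver g v₀)) :=
      singularCohomology.map_one _
    rw [h1, one_smul, sub_self]
    exact Submodule.zero_mem _

/-- **Fulton's fact above the dimension (`n < p`) holds**, vacuously: the binder `∃ z ∈ W₀, codim z = p`
is unsatisfiable on the `n`-dimensional fibre `X₀` (`not_lt_of_coheight_eq`). Binder shape: that of
`fulton1998_flatFamily_cycleClass_specialises` with `n < p →` inserted after `(g : 𝒳 ⟶ V)`.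
[cite: Hartshorne1977, II Ex. 3.20 (d)] -/
theorem fulton1998_flatFamily_cycleClass_specialises_of_lt :
    ∀ ⦃n p : ℕ⦄ ⦃𝒳 V : SchemeOver ℂ⦄ (g : 𝒳 ⟶ V), n < p → IsSmoothProjectiveFamily g n →
    AlgebraicGeometry.Smooth V.hom →
    ∀ (𝒲 : Scheme) (ι : 𝒲 ⟶ 𝒳.left), IsClosedImmersion ι → Flat (ι ≫ g.left) →
    ∀ (v₀ : ComplexPoints V) (W₀ C : Set (fiberOver g v₀).left),
    IsClosed W₀ → IsIrreducible W₀ → IsClosed C →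
    Set.range (pullback.snd ι (fiberι g v₀).left).base = W₀ ∪ C → ¬ (W₀ ⊆ C) →
    (∀ z ∈ W₀ ∪ C, (p : ℕ∞) ≤ Order.coheight z) → (∃ z ∈ W₀, Order.coheight z = p) →
    ∃ (Γ : complexBetti 𝒳 (2 * p)) (w : complexBetti (fiberOver g v₀) (2 * p)) (c₀ : ℂ),
      (∀ t : ComplexPoints V,
        complexBetti.map (fiberι g t) (2 * p) Γ ∈ algebraicClasses (fiberOver g t) p) ∧
      w ∈ classesSupportedOn (fiberOver g v₀) W₀ (2 * p) ∧ w ≠ 0 ∧ c₀ ≠ 0 ∧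
      complexBetti.map (fiberι g v₀) (2 * p) Γ - c₀ • w ∈
        classesSupportedOn (fiberOver g v₀) C (2 * p) := by
  intro n p 𝒳 V g hlt hg _ 𝒲 ι _ _ v₀ W₀ C _ _ _ _ _ _ hz
  obtain ⟨z, -, hz⟩ := hz
  exact (not_lt_of_coheight_eq hg hz hlt).elim

/-- **Reduction of Fulton's fact to the interior range.** `fulton1998_flatFamily_cycleClass_specialises`
follows from its restriction to `0 < p ≤ n` (the hypothesis `h`: the fact's statement with
`0 < p → p ≤ n →` inserted after the binder `(g : 𝒳 ⟶ V)`): the complement is covered by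
`fulton1998_flatFamily_cycleClass_specialises_zero` (`p = 0`) and `not_lt_of_coheight_eq` (`p > n`, where
the last binder is unsatisfiable). So a discharge of the stub `stub_fultonSpecialises` may assume
`1 ≤ p ≤ n = dim X₀`; the consumer `BlochSpreadEightFour` uses `(n, p) = (8, 4)`.
[cite: Fulton1998, §10.1 Prop. 10.1 (a) and Cor. 10.1; §19.1 Lemma 19.1.1; §19.2 Cor. 19.2 (b)] -/
theorem fulton1998_flatFamily_cycleClass_specialises_of_interior
    (h : ∀ ⦃n p : ℕ⦄ ⦃𝒳 V : SchemeOver ℂ⦄ (g : 𝒳 ⟶ V), 0 < p → p ≤ n → IsSmoothProjectiveFamily g n →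
      AlgebraicGeometry.Smooth V.hom →
      ∀ (𝒲 : Scheme) (ι : 𝒲 ⟶ 𝒳.left), IsClosedImmersion ι → Flat (ι ≫ g.left) →
      ∀ (v₀ : ComplexPoints V) (W₀ C : Set (fiberOver g v₀).left),
      IsClosed W₀ → IsIrreducible W₀ → IsClosed C →
      Set.range (pullback.snd ι (fiberι g v₀).left).base = W₀ ∪ C → ¬ (W₀ ⊆ C) →
      (∀ z ∈ W₀ ∪ C, (p : ℕ∞) ≤ Order.coheight z) → (∃ z ∈ W₀, Order.coheight z = p) →
      ∃ (Γ : complexBetti 𝒳 (2 * p)) (w : complexBetti (fiberOver g v₀) (2 * p)) (c₀ : ℂ),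
        (∀ t : ComplexPoints V,
          complexBetti.map (fiberι g t) (2 * p) Γ ∈ algebraicClasses (fiberOver g t) p) ∧
        w ∈ classesSupportedOn (fiberOver g v₀) W₀ (2 * p) ∧ w ≠ 0 ∧ c₀ ≠ 0 ∧
        complexBetti.map (fiberι g v₀) (2 * p) Γ - c₀ • w ∈
          classesSupportedOn (fiberOver g v₀) C (2 * p)) :
    fulton1998_flatFamily_cycleClass_specialises := by
  intro n p 𝒳 V g hg hV 𝒲 ι hι hflat v₀ W₀ C hW₀ hirr hC hrange hWC hcodim hz
  rcases Nat.eq_zero_or_pos p with rfl | hp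
  · exact fulton1998_flatFamily_cycleClass_specialises_zero g hg hV 𝒲 ι hι hflat v₀ W₀ C hW₀ hirr hC
      hrange hWC hcodim hz
  rcases le_or_gt p n with hpn | hnp
  · exact h g hp hpn hg hV 𝒲 ι hι hflat v₀ W₀ C hW₀ hirr hC hrange hWC hcodim hz
  · exact fulton1998_flatFamily_cycleClass_specialises_of_lt g hnp hg hV 𝒲 ι hι hflat v₀ W₀ C hW₀
      hirr hC hrange hWC hcodim hz

end Summit.HodgeConjecture.HodgeConjecture.Theorems

end
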